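import Summits.ResolutionOfSingularities.ResolutionOfSingularities.Theorems.PurelyInseparableDim4JointForestFinitePlanKit
import Summits.ResolutionOfSingularities.ResolutionOfSingularities.Theorems.PurelyInseparableDim4JointTwoChartComputations
import Summits.ResolutionOfSingularities.ResolutionOfSingularities.Theorems.PurelyInseparableDim4JointForestInstance
import HarnessLib

/-!
# Purely inseparable four-folds: a DEPTH-THREE instance of the monotone joint forest via the finite-plan kit —
# `z^p + x₁^{3p} x₂` is order-reduced by THREE successive 3-fold blow-ups (brick S3 (c) «joint point∘coordinate chains», part 29,
# cell `res-dim4-pi`)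

[OURS · counted 0] (D-0157 DOOR 2; desk WORD #66 (4)(c), #74 (g), #99 (d); frame `PIDim4.TerminationImpliesOrderReduction`,
S3 (c); host item stmt-ResolutionOfSingularities-16155, helper). Nothing here proves resolution of singularities in
dimension ≥ 4 / characteristic `p` — NOT here, not anywhere in this programme.

`F = x₁^{3p} x₂`, `K = K̄` of characteristic `p` (any prime). The order-`p` locus of `z^p + F` is the 3-fold `{x₁ = 0}`; blowing it up,
the `x₁`-chart transform is `x₁^{2p} x₂`, order `p` along the WHOLE exceptional section `V(z′, y₁)` (the child, `S″ = S = {x₁}`);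
again: `x₁^p x₂`, child `V(z″, y₁)`; again: `x₂` — linear, DEAD. The plan has depth three; part 28's
`exists_isMarkedResolution_finite_plan_cert` with `Q = {q₀, q₁, q₂}` (the three states), rank `2, 1, 0`, no leaves, gives:

* **`exists_isMarkedResolution_inst₈`** — `(𝔸⁵_K, (z^p + x₁^{3p} x₂)·𝒪, [], p)` admits a marked resolution (BGMW Def. 3.1.3), every `p`.
  UNCONDITIONAL; the first certificate of depth three (the monomial case: exceptional sections re-blown).

AI-produced formalisation, weaker than expert review. bears_on: LADDER-RESOLUTION:D157-DOOR2 (res-dim4-pi · S3 (c) joint v2 ·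
depth-three instance).
-/

set_option linter.dupNamespace false -- D-0017: single-problem summit path `Summit.<S>.<S>.…` by design

noncomputable section

open MvPolynomial Finset CategoryTheory AlgebraicGeometry Opposite TopologicalSpace

namespace Summit.ResolutionOfSingularities.ResolutionOfSingularities.Theorems.PIDim4

open Literature.AlgebraicGeometry.Resolution
open Literature.AlgebraicGeometry.Resolution.Hauser2010
open Literature.AlgebraicGeometry.Resolution.AffinePointBlowup (P A γ coord Wtop ξ)

namespace Equimultiple

section Instance₈

variable {K : Type} [Field K] {p : ℕ} [hp : Fact p.Prime] [CharP K p]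

/-! ## §1 The monomials `x₁^m x₂` -/

omit hp [CharP K p] in
/-- The support of `x₁^m x₂` is its exponent. [folklore] -/
theorem mem_support_X_pow_mul_X {m : ℕ} {d : Fin 4 →₀ ℕ} (hd : d ∈ (X 0 ^ m * X 1 : MvPolynomial (Fin 4) K).support) :
    d = Finsupp.single 0 m + Finsupp.single 1 1 := by
  rw [X_pow_mul_X_eq_monomial] at hd
  exact Finset.mem_singleton.mp (Finset.mem_of_subset support_monomial_subset hd)

omit hp [CharP K p] in
/-- `x₁^m x₂ ≠ 0`. [folklore] -/
theorem X_pow_mul_X_ne_zero (m : ℕ) : (X 0 ^ m * X 1 : MvPolynomial (Fin 4) K) ≠ 0 := by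
  rw [X_pow_mul_X_eq_monomial, Ne, monomial_eq_zero]
  exact one_ne_zero

omit hp [CharP K p] in
/-- `x₁^m x₂` and `x₁^n x₂` differ for `m ≠ n`. [folklore] -/
theorem X_pow_mul_X_ne {m n : ℕ} (hmn : m ≠ n) : (X 0 ^ m * X 1 : MvPolynomial (Fin 4) K) ≠ X 0 ^ n * X 1 := by
  intro h
  rw [X_pow_mul_X_eq_monomial, X_pow_mul_X_eq_monomial] at h
  have hd : (Finsupp.single 0 m + Finsupp.single 1 1 : Fin 4 →₀ ℕ) = Finsupp.single 0 n + Finsupp.single 1 1 :=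
    MvPolynomial.monomial_left_injective (one_ne_zero' K) h
  have h0 := DFunLike.congr_fun hd 0
  simp at h0
  exact hmn h0

omit [CharP K p] in
/-- `x₁^m x₂` is clean (exponent `1` on `x₂`). [cite: HauserPerlega2019PRIMS, §2 (cleaning)] -/
theorem isClean_X_pow_mul_X (m : ℕ) :
    Literature.Barriers.ResolutionOfSingularities.HauserPerlega.IsClean p (X 0 ^ m * X 1 : MvPolynomial (Fin 4) K) := by
  intro d hd hpth
  rw [mem_support_X_pow_mul_X hd] at hpth
  have h0 : (Finsupp.single 0 m + Finsupp.single 1 1 : Fin 4 →₀ ℕ) 1 = 1 := by simp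
  have h := hpth 1 (by rw [Finsupp.mem_support_iff, h0]; exact one_ne_zero)
  rw [h0] at h
  exact hp.out.one_lt.ne' (Nat.dvd_one.mp h)

omit hp [CharP K p] in
/-- `V(z, x₁)` is permissible for `z^p + x₁^m x₂` when `p ≤ m`. [cite: HauserPerlega2019PRIMS, §2 (condition (1))] -/
theorem isPermissibleCentre_X_pow_mul_X {m : ℕ} (hm : p ≤ m) :
    IsPermissibleCentre p ({0} : Finset (Fin 4)) (X 0 ^ m * X 1 : MvPolynomial (Fin 4) K) := by
  refine ⟨⟨0, Finset.mem_singleton_self _⟩, Finset.le_inf fun d hd => ?_⟩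
  rw [mem_support_X_pow_mul_X hd]
  simp [degIn_singleton_zero]
  exact_mod_cast hm

omit hp [CharP K p] in
/-- **The `x₁`-chart transform of `x₁^{n+p} x₂` is `x₁^n x₂`.** [cite: HauserPerlega2019PRIMS, §2 (the x₁-chart)] -/
theorem chartTransform_X_pow_mul_X (n : ℕ) :
    CentreBlowup.chartTransform p ({0} : Finset (Fin 4)) 0 (X 0 ^ (n + p) * X 1 : MvPolynomial (Fin 4) K) = X 0 ^ n * X 1 := by
  rw [X_pow_mul_X_eq_monomial, CentreBlowup.chartTransform_monomial, CentreBlowup.chartExponent, degIn_singleton_zero]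
  have e1 : (Finsupp.single 0 (n + p) + Finsupp.single 1 1 : Fin 4 →₀ ℕ).update 0
      ((Finsupp.single 0 (n + p) + Finsupp.single 1 1 : Fin 4 →₀ ℕ) 0 - p) = Finsupp.single 0 n + Finsupp.single 1 1 := by
    ext i; fin_cases i <;> simp [Finsupp.update_apply]
  rw [e1, ← X_pow_mul_X_eq_monomial]

omit [CharP K p] in
/-- **The step along `(x₁, 0)`: `x₁^{n+p} x₂ ↦ x₁^n x₂`.** [cite: Hauser2010, §§F–G] -/
theorem step_F_X_pow_mul_X [DecidableEq K] (n : ℕ) (s : State K) (hs : s.F = X 0 ^ (n + p) * X 1) :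
    (CentreBlowup.step p ({0} : Finset (Fin 4)) 0 0 s).F = X 0 ^ n * X 1 := by
  show deletePthPowers p (PointBlowup.translate 0 (CentreBlowup.chartTransform p ({0} : Finset (Fin 4)) 0 s.F)) = _
  rw [hs, chartTransform_X_pow_mul_X, PointBlowup.translate_zero]
  exact Literature.Barriers.ResolutionOfSingularities.HauserPerlega.deletePthPowers_eq_self (isClean_X_pow_mul_X n)

omit hp [CharP K p] in
/-- The origin of the `x₁`-chart is equimultiple for `x₁^{n+p} x₂` when `p ≤ n + 1`. [cite: Hauser2010, §F] -/
theorem isEquimultiplePoint_X_pow_mul_X_origin [DecidableEq K] {n : ℕ} (hn : p ≤ n + 1) (s : State K)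
    (hs : s.F = X 0 ^ (n + p) * X 1) : CentreBlowup.IsEquimultiplePoint p ({0} : Finset (Fin 4)) 0 0 s := by
  intro d hd hdp
  unfold CentreBlowup.pointTransform
  rw [hs, chartTransform_X_pow_mul_X, PointBlowup.translate_zero]
  by_contra hne
  rw [mem_support_X_pow_mul_X (MvPolynomial.mem_support_iff.mpr hne), map_add, Finsupp.degree_single, Finsupp.degree_single] at hdp
  omega

omit [CharP K p] in
/-- **`x₁^p x₂` is DEAD for `V(z, x₁)`**: its chart transform `x₂` is linear. [cite: Hauser2010, §F (equiconstant points)] -/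
theorem not_isEquimultiplePoint_X_pow_p_mul_X [DecidableEq K] (b : Fin 4 → K) (s : State K) (hs : s.F = X 0 ^ p * X 1) :
    ¬ CentreBlowup.IsEquimultiplePoint p ({0} : Finset (Fin 4)) 0 b s := by
  intro h
  have h1 := h (Finsupp.single 1 1) (Finsupp.single_ne_zero.mpr one_ne_zero) (by rw [Finsupp.degree_single]; exact hp.out.one_lt)
  unfold CentreBlowup.pointTransform at h1
  rw [hs, show (X 0 ^ p * X 1 : MvPolynomial (Fin 4) K) = X 0 ^ (0 + p) * X 1 by rw [zero_add], chartTransform_X_pow_mul_X,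
    pow_zero, one_mul, coeff_single_one_translate] at h1
  simp at h1

omit [CharP K p] in
/-- **The root parameters of `x₁^{3p} x₂` lie on `{x₁ = 0}`** (`∂F/∂x₂ = x₁^{3p}`). [cite: Hauser2010, §F] -/
theorem roots_inst₈ (b : Fin 4 → K)
    (H : ∀ d : Fin 4 →₀ ℕ, d ≠ 0 → d.degree < p → coeff d (PointBlowup.translate b (X 0 ^ (3 * p) * X 1 : MvPolynomial (Fin 4) K)) = 0) :
    b 0 = 0 := by
  have h1 := eval_pderiv_eq_zero_of_forall_coeff b _ H 1
  simp [(pderiv (1 : Fin 4)).leibniz_pow, hp.out.ne_zero] at h1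
  exact h1

/-! ## §2 The certificate (via the finite-plan kit) -/

/-- **`z^p + x₁^{3p} x₂` ADMITS A MARKED RESOLUTION BY THREE SUCCESSIVE 3-FOLD BLOW-UPS** (`K = K̄` of characteristic `p`,
every prime `p`). [cite: BierstoneGrigorievMilmanWlodarczyk2011, Def. 3.1.3] [cite: HauserPerlega2019PRIMS, §2] [cite: Hauser2010, §F] -/
theorem exists_isMarkedResolution_inst₈ [IsAlgClosed K] [DecidableEq K] :
    ∃ (X' : Scheme.{0}) (ρ : X' ⟶ P 4 K) (M' : MarkedIdeal X'),
      IsMarkedResolution (⟨hypSheaf p (X 0 ^ (3 * p) * X 1 : MvPolynomial (Fin 4) K), [], p⟩ : MarkedIdeal (P 4 K)) ρ M' := by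
  classical
  have hp0 : p ≠ 0 := hp.out.ne_zero
  -- the three states
  set s₀ : State K := ⟨X 0 ^ (3 * p) * X 1, 0, ∅⟩ with hs₀
  set s₁ : State K := CentreBlowup.step p ({0} : Finset (Fin 4)) 0 0 s₀ with hs₁
  set s₂ : State K := CentreBlowup.step p ({0} : Finset (Fin 4)) 0 0 s₁ with hs₂
  have h3 : 3 * p = 2 * p + p := by ring
  have h2 : 2 * p = p + p := by ring
  have hF₀ : s₀.F = X 0 ^ (2 * p + p) * X 1 := by rw [← h3]
  have hF₁ : s₁.F = X 0 ^ (2 * p) * X 1 := step_F_X_pow_mul_X (2 * p) s₀ hF₀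
  have hF₁' : s₁.F = X 0 ^ (p + p) * X 1 := by rw [hF₁, h2]
  have hF₂ : s₂.F = X 0 ^ p * X 1 := step_F_X_pow_mul_X p s₁ hF₁'
  have hne₀₂ : (X 0 ^ (3 * p) * X 1 : MvPolynomial (Fin 4) K) ≠ X 0 ^ p * X 1 := X_pow_mul_X_ne (by omega)
  have hne₁₂ : (X 0 ^ (2 * p) * X 1 : MvPolynomial (Fin 4) K) ≠ X 0 ^ p * X 1 := X_pow_mul_X_ne (by omega)
  have hne₀₁ : (X 0 ^ (3 * p) * X 1 : MvPolynomial (Fin 4) K) ≠ X 0 ^ (2 * p) * X 1 := X_pow_mul_X_ne (by omega)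
  have hG₀ : deletePthPowers p (PointBlowup.translate (0 : Fin 4 → K) (X 0 ^ (3 * p) * X 1 : MvPolynomial (Fin 4) K)) = X 0 ^ (3 * p) * X 1 := by
    rw [PointBlowup.translate_zero]
    exact Literature.Barriers.ResolutionOfSingularities.HauserPerlega.deletePthPowers_eq_self (isClean_X_pow_mul_X _)
  -- the rules: blow up the exceptional section while the transform is `x₁^{m} x₂` with `m ≥ 2p`
  let live : State K → Prop := fun s => s.F = X 0 ^ (3 * p) * X 1 ∨ s.F = X 0 ^ (2 * p) * X 1
  let plan : State K → Finset (Fin 4) → Finset (Fin 4 × (Fin 4 → K) × Finset (Fin 4)) := fun s T =>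
    if live s ∧ T = ({0} : Finset (Fin 4)) then {((0 : Fin 4), (0 : Fin 4 → K), ({0} : Finset (Fin 4)))} else ∅
  let leaves : State K → Finset (Fin 4) → Finset (Fin 4 × (Fin 4 → K)) := fun _ _ => ∅
  let rk : State K × Finset (Fin 4) → ℕ := fun q => if q.1.F = X 0 ^ (3 * p) * X 1 then 2 else if q.1.F = X 0 ^ (2 * p) * X 1 then 1 else 0
  have hplan₀ : plan s₀ {0} = {((0 : Fin 4), (0 : Fin 4 → K), ({0} : Finset (Fin 4)))} := if_pos ⟨Or.inl rfl, rfl⟩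
  have hplan₁ : plan s₁ {0} = {((0 : Fin 4), (0 : Fin 4 → K), ({0} : Finset (Fin 4)))} := if_pos ⟨Or.inr hF₁, rfl⟩
  have hplan₂ : plan s₂ {0} = ∅ := if_neg fun h => by
    rcases h.1 with h' | h'
    · exact hne₀₂ (h'.symm.trans hF₂)
    · exact hne₁₂ (h'.symm.trans hF₂)
  have hrk₀ : rk (s₀, {0}) = 2 := if_pos rfl
  have hrk₁ : rk (s₁, {0}) = 1 := by
    show (if s₁.F = _ then 2 else if s₁.F = _ then 1 else 0) = 1
    rw [if_neg (fun h => hne₀₁ (h.symm.trans hF₁)), if_pos hF₁]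
  have hrk₂ : rk (s₂, {0}) = 0 := by
    show (if s₂.F = _ then 2 else if s₂.F = _ then 1 else 0) = 0
    rw [if_neg (fun h => hne₀₂ (h.symm.trans hF₂)), if_neg (fun h => hne₁₂ (h.symm.trans hF₂))]
  -- the finite set of pairs
  let Q : Finset (State K × Finset (Fin 4)) := {(s₀, {0}), (s₁, {0}), (s₂, {0})}
  have hQ : ∀ q ∈ Q, q = (s₀, {0}) ∨ q = (s₁, {0}) ∨ q = (s₂, {0}) := fun q hq => by
    simpa [Q, Finset.mem_insert, Finset.mem_singleton] using hq
  refine exists_isMarkedResolution_finite_plan_cert (X 0 ^ (3 * p) * X 1) (X_pow_mul_X_ne_zero _) (isClean_X_pow_mul_X _)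
    (0 : Fin 4 → K) ({0} : Finset (Fin 4)) s₀ (by rw [hG₀]) (hF₀ ▸ isPermissibleCentre_X_pow_mul_X (by omega))
    (fun b' H i hi => ?_) plan leaves Q (by simp [Q]) (fun q hq e he => ?_) rk (fun q hq e he => ?_) (fun q hq e he => ?_)
    (fun q hq e he e' he' hne => ?_) (fun q hq l hl => absurd hl (Finset.notMem_empty l)) (fun q hq j' b' hj' hb' _ heq => ?_)
  · -- roots on the member
    rw [Finset.mem_singleton] at hi
    subst hi
    exact roots_inst₈ b' H
  · -- closed under the child map
    rcases hQ q hq with rfl | rfl | rfl <;> dsimp only at he ⊢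
    · rw [hplan₀, Finset.mem_singleton] at he
      subst he
      exact Finset.mem_insert_of_mem (Finset.mem_insert_self _ _)
    · rw [hplan₁, Finset.mem_singleton] at he
      subst he
      exact Finset.mem_insert_of_mem (Finset.mem_insert_of_mem (Finset.mem_singleton_self _))
    · rw [hplan₂] at he
      exact absurd he (Finset.notMem_empty e)
  · -- the rank decreases
    rcases hQ q hq with rfl | rfl | rfl <;> dsimp only at he ⊢
    · rw [hplan₀, Finset.mem_singleton] at he
      subst he
      dsimp only
      rw [hrk₀, show rk (CentreBlowup.step p {0} 0 0 s₀, {0}) = 1 from hrk₁]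
      exact one_lt_two
    · rw [hplan₁, Finset.mem_singleton] at he
      subst he
      dsimp only
      rw [hrk₁, show rk (CentreBlowup.step p {0} 0 0 s₁, {0}) = 0 from hrk₂]
      exact zero_lt_one
    · rw [hplan₂] at he
      exact absurd he (Finset.notMem_empty e)
  · -- entries are admissible
    rcases hQ q hq with rfl | rfl | rfl <;> dsimp only at he ⊢
    · rw [hplan₀, Finset.mem_singleton] at he
      subst he
      dsimp only
      refine ⟨Finset.mem_singleton_self _, rfl, Finset.Subset.refl _,
        isEquimultiplePoint_X_pow_mul_X_origin (by omega) s₀ hF₀, ?_⟩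
      rw [step_F_X_pow_mul_X (2 * p) s₀ hF₀]
      exact isPermissibleCentre_X_pow_mul_X (by omega)
    · rw [hplan₁, Finset.mem_singleton] at he
      subst he
      dsimp only
      refine ⟨Finset.mem_singleton_self _, rfl, Finset.Subset.refl _,
        isEquimultiplePoint_X_pow_mul_X_origin (by omega) s₁ hF₁', ?_⟩
      rw [step_F_X_pow_mul_X p s₁ hF₁']
      exact isPermissibleCentre_X_pow_mul_X le_rfl
    · rw [hplan₂] at he
      exact absurd he (Finset.notMem_empty e)
  · -- single entries: separation vacuous
    rcases hQ q hq with rfl | rfl | rfl <;> dsimp only at he he'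
    · rw [hplan₀, Finset.mem_singleton] at he he'
      exact absurd (he.trans he'.symm) hne
    · rw [hplan₁, Finset.mem_singleton] at he he'
      exact absurd (he.trans he'.symm) hne
    · rw [hplan₂] at he
      exact absurd he (Finset.notMem_empty e)
  · -- cover: live states agree with the entry; the last state is dead
    rcases hQ q hq with rfl | rfl | rfl <;> dsimp only at hj' hb' heq ⊢
    · rw [Finset.mem_singleton] at hj'
      subst hj'
      rw [hplan₀]
      exact Or.inl ⟨_, Finset.mem_singleton_self _, rfl, fun i hi => by
        rw [Finset.mem_singleton] at hi; subst hi; exact hb'⟩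
    · rw [Finset.mem_singleton] at hj'
      subst hj'
      rw [hplan₁]
      exact Or.inl ⟨_, Finset.mem_singleton_self _, rfl, fun i hi => by
        rw [Finset.mem_singleton] at hi; subst hi; exact hb'⟩
    · rw [Finset.mem_singleton] at hj'
      subst hj'
      exact absurd heq (not_isEquimultiplePoint_X_pow_p_mul_X b' s₂ hF₂)

end Instance₈

end Equimultiple

end Summit.ResolutionOfSingularities.ResolutionOfSingularities.Theorems.PIDim4

end
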